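import Mathlib
import HarnessLib
import Summits.HubbardSuperconductivity.HubbardSuperconductivity.Theses.ChiralWindow
import Summits.HubbardSuperconductivity.HubbardSuperconductivity.Theorems.ChiralWindowCwChiralConstructionCornerReduction

/-!
# Crux `CwChiralConstruction` (stmt-HubbardSuperconductivity-1740): the residual form

Route `HubbardSuperconductivity/ChiralWindow`, rank-2 crux ("the programme"). Support file
(`--supports stmt-HubbardSuperconductivity-1740`).

The crux couples a DENSITY clause (grand-canonical tracial ground-state density of
`hubbardTorusWith 2 (L+1) 1 U μ` tends to `1 - δ`, `δ ∈ [3/10, 12/25]`) with an ORDER clause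
(`exp(-C/U²) ≤ dWaveOrderParameter U μ`). The density clause is settled technology in the tree
(`cw_genericDensity`: Griffiths' lemma + concavity + the free band, landed p90642/p85392/p86909 and the
sibling p76736): for every `U` below a threshold and every `μ`-interval whose FREE fillings lie in
`[13/25 + η, 7/10 - η]`, some `μ` inside the interval satisfies the density clause. This file records
the consequence for any future prover of the crux: **only the order clause is left, and it may be
proved grand-canonically at fixed chemical potential, never touching interacting densities**.

* `cwChiralConstruction_of_orderOnOpenSet` — if for every small `U` the Koma–Tasaki `d`-wave order
  parameter is `≥ exp(-C/U²)` on SOME open `μ`-interval whose closure has free fillings in the window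
  (strictly inside `[13/25, 7/10]`), the crux holds. This is the weakest residual the landed frame
  supports (it is the statement of the registered stub `stub_chiralCornerWindow` of line
  `susceptibility-rise-budget` with the corner/transport data replaced by the floor they were meant to
  produce).
* `cwChiralConstruction_of_orderOnFillingWindow` — the natural textbook form: if there are fillings
  `13/25 < n₁ < n₂ < 7/10` such that for every small `U` and EVERY `μ` with free filling in `[n₁, n₂]`
  the order parameter is `≥ exp(-C/U²)` (Kohn–Luttinger `d_{x²-y²}` order on a filling window, stated
  with the tree's `dWaveOrderParameter`), the crux holds (intermediate value theorem for the continuous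
  free filling, `stub_freeBandLimit`, then the previous theorem).

* `cwChiralConstruction_forces_orderNearFillingWindow` — converse bookkeeping in the same vocabulary:
  the crux implies, for every tolerance `τ > 0` and all small `U`, the order floor at SOME `μ` whose
  free filling lies in `[13/25 - τ, 7/10 + τ]` (the density clause pins the free filling:
  `CwResidual.abs_filling_sub_le_of_tendsto_density`, Griffiths chord sandwich in the limit + `|e - e₀| ≤ U`
  + mean value theorem + uniform continuity of the filling). The disprover's `μ`-form of this
  (`cwChiralConstruction_pinned`, `Negative/DensityPinning.lean`: some `μ ∈ [-37/10, -1/20]`) is landed.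

So the crux is sandwiched between "Kohn–Luttinger `d`-wave order at one `μ` of (nearly) the filling
window per `U`" and "… at every `μ` of a sub-window"; the daylight is the density clause at non-generic
`μ` and the `∃ μ`/`∀ μ` quantifier over the window. No definitions; everything is proved.
[folklore: Griffiths 1964 + the cited tree lemmas]
-/

set_option linter.dupNamespace false

namespace Summit.HubbardSuperconductivity.HubbardSuperconductivity.Theorems

open Literature.MathematicalPhysics.QuantumLattice Filter
open Summit.HubbardSuperconductivity.HubbardSuperconductivity.Theses.ChiralWindow
open scoped Topology

/-- **Residual form 1 (order on an open `μ`-set ⇒ crux).** If for some `η > 0`, all `U ∈ (0, U₀)`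
admit a `μ`-interval `[μ₁, μ₂]` with free fillings in `[13/25 + η, 7/10 - η]` on which (open interval)
`exp(-C/U²) ≤ dWaveOrderParameter U μ`, then `CwChiralConstruction`: `cw_genericDensity` supplies a
`μ ∈ (μ₁, μ₂)` and a `δ ∈ [3/10, 12/25]` with the density clause, and the floor holds there.
[folklore: Griffiths 1964; composition of landed tree lemmas] -/
theorem cwChiralConstruction_of_orderOnOpenSet
    (h : ∃ η U₀ C : ℝ, 0 < η ∧ 0 < U₀ ∧ 0 < C ∧ ∀ U ∈ Set.Ioo (0 : ℝ) U₀, ∃ μ₁ μ₂ : ℝ, μ₁ < μ₂ ∧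
      (∀ μ ∈ Set.Icc μ₁ μ₂,
        KohnLuttinger.filling (squareDispersion 1 0) μ ∈ Set.Icc (13 / 25 + η) (7 / 10 - η)) ∧
      ∀ μ ∈ Set.Ioo μ₁ μ₂, Real.exp (-C / U ^ 2) ≤ dWaveOrderParameter U μ) :
    CwChiralConstruction := by
  obtain ⟨η, U₀, C, hη, hU₀, hC, core⟩ := h
  obtain ⟨U₁, hU₁, dens⟩ := cw_genericDensity η hη
  refine ⟨min U₀ U₁, lt_min hU₀ hU₁, C, hC, fun U hU => ?_⟩
  have hUU₀ : U ∈ Set.Ioo (0 : ℝ) U₀ := ⟨hU.1, hU.2.trans_le (min_le_left _ _)⟩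
  have hUU₁ : U ∈ Set.Ioo (0 : ℝ) U₁ := ⟨hU.1, hU.2.trans_le (min_le_right _ _)⟩
  obtain ⟨μ₁, μ₂, h12, hfill, hfloor⟩ := core U hUU₀
  obtain ⟨μ, hμ, δ, hδ, hdens⟩ := dens U hUU₁ μ₁ μ₂ h12 hfill
  exact ⟨δ, hδ, μ, hdens, hfloor μ hμ⟩

/-- **Residual form 2 (Kohn–Luttinger `d`-wave order on a filling window ⇒ crux).** If there are
fillings `13/25 < n₁ < n₂ < 7/10`, a threshold `U₀ > 0` and a constant `C > 0` such that for every
`U ∈ (0, U₀)` and every chemical potential `μ` whose FREE filling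
`KohnLuttinger.filling (squareDispersion 1 0) μ` lies in `[n₁, n₂]` the Koma–Tasaki order parameter
satisfies `exp(-C/U²) ≤ dWaveOrderParameter U μ`, then `CwChiralConstruction`. Proof: the free filling
is continuous with values `0` at `μ = -4` and `2` at `μ = 5` (`stub_freeBandLimit`), so the intermediate
value theorem gives `μ⋆` with filling `(n₁ + n₂)/2` and continuity an interval around `μ⋆` with fillings
in `(n₁, n₂) ⊆ [13/25 + η, 7/10 - η]`, `η = min (n₁ - 13/25) (7/10 - n₂)`; conclude with
`cwChiralConstruction_of_orderOnOpenSet`. [folklore: intermediate value theorem + Griffiths 1964] -/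
theorem cwChiralConstruction_of_orderOnFillingWindow
    (h : ∃ n₁ n₂ U₀ C : ℝ, 13 / 25 < n₁ ∧ n₁ < n₂ ∧ n₂ < 7 / 10 ∧ 0 < U₀ ∧ 0 < C ∧
      ∀ U ∈ Set.Ioo (0 : ℝ) U₀, ∀ μ : ℝ,
        KohnLuttinger.filling (squareDispersion 1 0) μ ∈ Set.Icc n₁ n₂ →
          Real.exp (-C / U ^ 2) ≤ dWaveOrderParameter U μ) :
    CwChiralConstruction := by
  obtain ⟨n₁, n₂, U₀, C, hn₁, hn₁₂, hn₂, hU₀, hC, H⟩ := h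
  obtain ⟨_, _, _, hFc, hF0, hF2⟩ := stub_freeBandLimit
  set F : ℝ → ℝ := fun μ => KohnLuttinger.filling (squareDispersion 1 0) μ with hFdef
  -- intermediate value theorem on `[-4, 5]`: a `μ⋆` with filling `(n₁ + n₂)/2`
  have hFm4 : F (-4) = 0 := hF0 (-4) le_rfl
  have hF5 : F 5 = 2 := hF2 5 (by norm_num)
  have hmid : (n₁ + n₂) / 2 ∈ Set.Icc (F (-4)) (F 5) := by
    rw [hFm4, hF5]
    constructor <;> linarith
  obtain ⟨μs, _, hμs⟩ :=
    intermediate_value_Icc (by norm_num : (-4 : ℝ) ≤ 5) hFc.continuousOn hmid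
  -- continuity at `μ⋆`: fillings stay in `(n₁, n₂)` on a neighbourhood
  have hw : 0 < (n₂ - n₁) / 2 := by linarith
  obtain ⟨r, hr, hball⟩ := Metric.continuousAt_iff.1 (hFc.continuousAt (x := μs)) _ hw
  have hnear : ∀ μ ∈ Set.Icc (μs - r / 2) (μs + r / 2), n₁ < F μ ∧ F μ < n₂ := by
    intro μ hμ
    have hd : dist μ μs < r := by
      rw [Real.dist_eq, abs_lt]
      constructor <;> linarith [hμ.1, hμ.2]
    have := hball hd
    rw [Real.dist_eq, abs_lt, hμs] at this
    constructor <;> linarith [this.1, this.2]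
  -- the window margin
  set η : ℝ := min (n₁ - 13 / 25) (7 / 10 - n₂) with hηdef
  have hη : 0 < η := lt_min (by linarith) (by linarith)
  have hη₁ : η ≤ n₁ - 13 / 25 := min_le_left _ _
  have hη₂ : η ≤ 7 / 10 - n₂ := min_le_right _ _
  refine cwChiralConstruction_of_orderOnOpenSet ⟨η, U₀, C, hη, hU₀, hC, fun U hU => ?_⟩
  refine ⟨μs - r / 2, μs + r / 2, by linarith, fun μ hμ => ?_, fun μ hμ => ?_⟩
  · obtain ⟨h1, h2⟩ := hnear μ hμ
    exact ⟨by linarith, by linarith⟩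
  · obtain ⟨h1, h2⟩ := hnear μ (Set.Ioo_subset_Icc_self hμ)
    exact H U hU μ ⟨h1.le, h2.le⟩

/-- **Registered reduction `stub_cruxOfKLOrderOnFillingWindow`** (sub-goal of crux
stmt-HubbardSuperconductivity-1740, residual skeleton `Lines/residual-kl-order.lean`): the statement
of the skeleton's single open stub `stub_klDWaveOrderOnFillingWindow` (Kohn–Luttinger `d`-wave order
on a free-filling window) implies `CwChiralConstruction` — `cwChiralConstruction_of_orderOnFillingWindow`
in arrow form, so that the crux closes by modus ponens from that stub alone. [folklore] -/
theorem stub_cruxOfKLOrderOnFillingWindow :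
    (∃ n₁ n₂ U₀ C : ℝ, 13 / 25 < n₁ ∧ n₁ < n₂ ∧ n₂ < 7 / 10 ∧ 0 < U₀ ∧ 0 < C ∧ ∀ U ∈ Set.Ioo (0 : ℝ) U₀, ∀ μ : ℝ, KohnLuttinger.filling (squareDispersion 1 0) μ ∈ Set.Icc n₁ n₂ → Real.exp (-C / U ^ 2) ≤ dWaveOrderParameter U μ) → CwChiralConstruction :=
  fun h => cwChiralConstruction_of_orderOnFillingWindow h

/-! ### Converse bookkeeping in the same vocabulary: the density clause pins the FREE filling -/

/-- **The free filling is uniformly continuous on `ℝ`** (it is continuous, `0` on `(-∞, -4]` and `2` on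
`(4, ∞)`): for `ε > 0` there is `Δ ∈ (0, 1/2]` with `|F x - F y| < ε` whenever `|x - y| < Δ`.
[folklore: Heine–Cantor on `[-5, 5]` plus the constant tails] -/
theorem CwResidual.filling_uniform_modulus {ε : ℝ} (hε : 0 < ε) :
    ∃ Δ : ℝ, 0 < Δ ∧ Δ ≤ 1 / 2 ∧ ∀ x y : ℝ, |x - y| < Δ →
      |KohnLuttinger.filling (squareDispersion 1 0) x -
        KohnLuttinger.filling (squareDispersion 1 0) y| < ε := by
  obtain ⟨_, _, _, hFc, hF0, hF2⟩ := stub_freeBandLimit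
  obtain ⟨Δ, hΔ, hΔ2, hmod⟩ :=
    CwDensity.exists_modulus (F := fun μ => KohnLuttinger.filling (squareDispersion 1 0) μ) hFc hε
  refine ⟨Δ, hΔ, hΔ2, fun x y hxy => ?_⟩
  have hxy' := abs_lt.1 hxy
  by_cases hx : x ∈ Set.Icc (-5 : ℝ) 5
  · by_cases hy : y ∈ Set.Icc (-5 : ℝ) 5
    · exact hmod x hx y hy hxy
    · -- `y` outside `[-5, 5]`, `x` inside and `Δ ≤ 1/2`-close: both in the same constant tail
      rw [Set.mem_Icc, not_and_or, not_le, not_le] at hy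
      rcases hy with hy | hy
      · rw [hF0 x (by linarith [hx.1]), hF0 y (by linarith)]
        simpa using hε
      · rw [hF2 x (by linarith [hx.2]), hF2 y (by linarith)]
        simpa using hε
  · rw [Set.mem_Icc, not_and_or, not_le, not_le] at hx
    rcases hx with hx | hx
    · rw [hF0 x (by linarith), hF0 y (by linarith)]
      simpa using hε
    · rw [hF2 x (by linarith), hF2 y (by linarith)]
      simpa using hε

/-- **The density clause pins the free filling.** For every tolerance `τ > 0` there is `U₂ > 0` such
that for `0 ≤ U < U₂` and every `μ`: if the grand-canonical tracial ground-state density of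
`hubbardTorusWith 2 (L+1) 1 U μ` converges to `n`, then the FREE filling at `μ` is within `τ` of `n`.
Proof: the finite-volume Griffiths chord sandwich (`gcNumber_torus_mem_Icc_slope`) passes to the
thermodynamic limit (`stub_torusGcEnergyDensityLimit`), the interacting limit is within `U` of the
free one (`CwDensity.free_sandwich_of_tendsto`), the free chords are fillings at intermediate points
(mean value theorem, `e₀' = -filling`), and the filling is uniformly continuous. [folklore: Griffiths
1964; Ruelle 1969] -/
theorem CwResidual.abs_filling_sub_le_of_tendsto_density {τ : ℝ} (hτ : 0 < τ) :
    ∃ U₂ : ℝ, 0 < U₂ ∧ ∀ U : ℝ, 0 ≤ U → U < U₂ → ∀ μ n : ℝ,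
      Tendsto (fun L : ℕ => ((hubbardTorusWith 2 (L + 1) 1 U μ).groundStateFunctional
        totalNumber).re / ((L + 1 : ℕ) : ℝ) ^ 2) atTop (𝓝 n) →
      |KohnLuttinger.filling (squareDispersion 1 0) μ - n| ≤ τ := by
  obtain ⟨Δ, hΔ, _, hmod⟩ := CwResidual.filling_uniform_modulus (half_pos hτ)
  obtain ⟨e₀, he₀, hder, _, _, _⟩ := stub_freeBandLimit
  set F : ℝ → ℝ := fun μ => KohnLuttinger.filling (squareDispersion 1 0) μ with hFdef
  -- chord length `ε = Δ/2`, coupling threshold `U₂ = τ ε / 2` (so that `U/ε ≤ τ/2`)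
  set ε : ℝ := Δ / 2 with hεdef
  have hε : 0 < ε := by positivity
  refine ⟨τ * ε / 2, by positivity, fun U hU0 hU2 μ n hn => ?_⟩
  have hUε : U / ε ≤ τ / 2 := by
    rw [div_le_iff₀ hε]; linarith
  -- thermodynamic limits of the interacting energy density at `μ - ε, μ, μ + ε`
  choose e he using stub_torusGcEnergyDensityLimit
  -- (1) the chord sandwich in the limit: `(e(μ-ε) - e μ)/ε ≤ n ≤ (e μ - e(μ+ε))/ε`
  have hlow : (e U (μ - ε) - e U μ) / ε ≤ n := by
    refine le_of_tendsto_of_tendsto' (((he U (μ - ε)).sub (he U μ)).div_const ε) hn fun L => ?_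
    have h := (gcNumber_torus_mem_Icc_slope (L + 1) 1 U μ hε).1
    have hN : (0 : ℝ) < ((L + 1 : ℕ) : ℝ) ^ 2 := by positivity
    rw [← sub_div, div_right_comm]
    exact div_le_div_of_nonneg_right h hN.le
  have hup : n ≤ (e U μ - e U (μ + ε)) / ε := by
    refine le_of_tendsto_of_tendsto' hn (((he U μ).sub (he U (μ + ε))).div_const ε) fun L => ?_
    have h := (gcNumber_torus_mem_Icc_slope (L + 1) 1 U μ hε).2
    have hN : (0 : ℝ) < ((L + 1 : ℕ) : ℝ) ^ 2 := by positivity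
    rw [← sub_div, div_right_comm]
    exact div_le_div_of_nonneg_right h hN.le
  -- (2) interacting limits are within `U` of the free ones
  have hs0 := CwDensity.free_sandwich_of_tendsto hU0 (he U μ) (he₀ μ)
  have hsm := CwDensity.free_sandwich_of_tendsto hU0 (he U (μ - ε)) (he₀ (μ - ε))
  have hsp := CwDensity.free_sandwich_of_tendsto hU0 (he U (μ + ε)) (he₀ (μ + ε))
  -- (3) free chords are fillings at intermediate points
  obtain ⟨ξ, hξ, hξeq⟩ := CwDensity.exists_slope_eq hder (show μ < μ + ε by linarith)
  obtain ⟨ξ', hξ', hξ'eq⟩ := CwDensity.exists_slope_eq hder (show μ - ε < μ by linarith)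
  have hchord_up : (e₀ μ - e₀ (μ + ε)) / ε = F ξ := by
    have h1 : (e₀ (μ + ε) - e₀ μ) / (μ + ε - μ) = -F ξ := hξeq.symm
    rw [show μ + ε - μ = ε by ring] at h1
    rw [show e₀ μ - e₀ (μ + ε) = -(e₀ (μ + ε) - e₀ μ) by ring, neg_div, h1, neg_neg]
  have hchord_low : (e₀ (μ - ε) - e₀ μ) / ε = F ξ' := by
    have h1 : (e₀ μ - e₀ (μ - ε)) / (μ - (μ - ε)) = -F ξ' := hξ'eq.symm
    rw [show μ - (μ - ε) = ε by ring] at h1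
    rw [show e₀ (μ - ε) - e₀ μ = -(e₀ μ - e₀ (μ - ε)) by ring, neg_div, h1, neg_neg]
  -- (4) uniform continuity of the filling at distance `< Δ`
  have hξF : |F ξ - F μ| < τ / 2 := hmod ξ μ (by
    rw [abs_lt]; constructor <;> linarith [hξ.1, hξ.2])
  have hξ'F : |F ξ' - F μ| < τ / 2 := hmod ξ' μ (by
    rw [abs_lt]; constructor <;> linarith [hξ'.1, hξ'.2])
  -- assemble: `n ≤ (e₀ μ + U - e₀(μ+ε))/ε = F ξ + U/ε`, `n ≥ (e₀(μ-ε) - e₀ μ - U)/ε = F ξ' - U/ε`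
  have hup' : n ≤ F ξ + U / ε := by
    have h1 : (e U μ - e U (μ + ε)) / ε ≤ (e₀ μ + U - e₀ (μ + ε)) / ε :=
      div_le_div_of_nonneg_right (by linarith [hs0.2, hsp.1]) hε.le
    have h2 : (e₀ μ + U - e₀ (μ + ε)) / ε = (e₀ μ - e₀ (μ + ε)) / ε + U / ε := by ring
    linarith [h1, h2, hchord_up]
  have hlow' : F ξ' - U / ε ≤ n := by
    have h1 : (e₀ (μ - ε) - (e₀ μ + U)) / ε ≤ (e U (μ - ε) - e U μ) / ε :=
      div_le_div_of_nonneg_right (by linarith [hsm.1, hs0.2]) hε.le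
    have h2 : (e₀ (μ - ε) - (e₀ μ + U)) / ε = (e₀ (μ - ε) - e₀ μ) / ε - U / ε := by ring
    linarith [h1, h2, hchord_low]
  rw [abs_le]
  have h3 := (abs_lt.1 hξF)
  have h4 := (abs_lt.1 hξ'F)
  constructor <;> linarith

/-- **Converse bookkeeping (crux ⇒ order at a `μ` whose FREE filling is near the window).** If
`CwChiralConstruction` holds with constant `C`, then for every tolerance `τ > 0` and all `U` below a
threshold there is a chemical potential `μ` whose free filling lies in `[13/25 - τ, 7/10 + τ]` and at
which `exp(-C/U²) ≤ dWaveOrderParameter U μ`. Together with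
`cwChiralConstruction_of_orderOnFillingWindow` this brackets the crux between the Kohn–Luttinger
`d`-wave order statement at SOME `μ` of (nearly) the free-filling window `[13/25, 7/10]` per `U`, and
the same statement at EVERY `μ` of a sub-window. [folklore: Griffiths 1964 + the tree lemmas] -/
theorem cwChiralConstruction_forces_orderNearFillingWindow (h : CwChiralConstruction) :
    ∃ C : ℝ, 0 < C ∧ ∀ τ : ℝ, 0 < τ → ∃ U₂ : ℝ, 0 < U₂ ∧ ∀ U ∈ Set.Ioo (0 : ℝ) U₂, ∃ μ : ℝ,
      KohnLuttinger.filling (squareDispersion 1 0) μ ∈ Set.Icc (13 / 25 - τ) (7 / 10 + τ) ∧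
        Real.exp (-C / U ^ 2) ≤ dWaveOrderParameter U μ := by
  obtain ⟨U₀, hU₀, C, hC, H⟩ := h
  refine ⟨C, hC, fun τ hτ => ?_⟩
  obtain ⟨U₂, hU₂, hpin⟩ := CwResidual.abs_filling_sub_le_of_tendsto_density hτ
  refine ⟨min U₀ U₂, lt_min hU₀ hU₂, fun U hU => ?_⟩
  obtain ⟨δ, hδ, μ, hdens, hfloor⟩ := H U ⟨hU.1, hU.2.trans_le (min_le_left _ _)⟩
  have hF := hpin U hU.1.le (hU.2.trans_le (min_le_right _ _)) μ (1 - δ) hdens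
  refine ⟨μ, ?_, hfloor⟩
  rw [abs_le] at hF
  exact ⟨by linarith [hδ.2, hF.1], by linarith [hδ.1, hF.2]⟩

end Summit.HubbardSuperconductivity.HubbardSuperconductivity.Theorems
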